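import Summits.ResolutionOfSingularities.ResolutionOfSingularities.Theorems.WeightedInvariantLocalWeightedDropPlaneNonNCCount

/-!
# `WeightedInvariant.LocalWeightedDrop` (stmt-ResolutionOfSingularities-8899): the registered stub
`stub_planeGermNonNCCountDischarge` closed BY NAME

The ledger carries, on the crux item `LocalWeightedDrop`, the registered stub

  `stub_planeGermNonNCCountDischarge : ∀ (k : Type) [Field k], Literature.AlgebraicGeometry.Resolution.PlaneGermNonNCCount k`

(registered 2026-08-16, the fact-debt form of the Literature named fact `PlaneGermNonNCCount` = strong embedded
resolution of plane curve germs by point blow-ups in the chart vocabulary of the local cobordant game: a count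
`ν : k[[x₀,x₁]] → ℕ` vanishing exactly on normal-crossings germs, monotone along divisibility, and dropping on some
slice of the strict transform under every point blow-up of a non-normal-crossings germ).

The mathematics was proved in the tree on 2026-08-16 (line `hasse-ridge-face-selection`, file
`Theorems/WeightedInvariantLocalWeightedDropPlaneNonNCCount.lean`: `stub_planeNonNCCount_allFields`, composed from the
bad-chain assembly `noInfiniteBadChain` and the blow-up toolkit), but under a different name, so the registered stub stayed
ACTIVE in the census.  This file lands the registered name with the registered signature, verbatim; the proof is the tree
theorem.  Nothing here is new mathematics and nothing here bears on the open wide-apex stubs of skeleton v36.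

[OURS · bookkeeping · closes one registered stub of stmt-ResolutionOfSingularities-8899 by name; proves no summit]
-/

set_option linter.dupNamespace false -- mandated namespace of this single-conjunct summit

namespace Summit.ResolutionOfSingularities.ResolutionOfSingularities.Theorems

/-- **Registered stub `stub_planeGermNonNCCountDischarge` of crux `LocalWeightedDrop` (stmt-ResolutionOfSingularities-8899),
closed by name.**  For every field `k : Type` the Literature named fact
`Literature.AlgebraicGeometry.Resolution.PlaneGermNonNCCount k` holds (strong embedded resolution of plane curve germs
in chart form).  Proof: the tree theorem `stub_planeNonNCCount_allFields`
(`Theorems/WeightedInvariantLocalWeightedDropPlaneNonNCCount.lean`). -/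
theorem stub_planeGermNonNCCountDischarge :
    ∀ (k : Type) [Field k], Literature.AlgebraicGeometry.Resolution.PlaneGermNonNCCount k :=
  stub_planeNonNCCount_allFields

end Summit.ResolutionOfSingularities.ResolutionOfSingularities.Theorems
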